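import Summits.HubbardSuperconductivity.HubbardSuperconductivity.Theorems.AnisotropyChordTransferFibre3FinXDCheck

/-!
# Route `AnisotropyChord` / H0 rotor rung: FIN per-`L` row-D (KT-2a″) SUB-CELL facts, `L = 10` (0–5)

Row-D facts `xdCellAny0 10 (49/50) la lb aD = true` on quarter sub-cells of the combined cells whose side condition needs `aD ≈ .04` (mechhunt STATUS p3 g7 REPORT 3).
Prover seat `hubbard-h0-rotor-p3` g7; helper for piece A = stmt-HubbardSuperconductivity-23918 of rung 19089 (`--supports`, helper class).
WHAT THIS IS NOT: nothing here proves superconductivity in the Hubbard model (rotor TARGET as worded stays FALSE, g15 verdict); kernel facts /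
assembly for ONE conditional reduction at one `L`.  No sorry.
-/

set_option linter.dupNamespace false
set_option autoImplicit false

namespace Summit.HubbardSuperconductivity.HubbardSuperconductivity.Theorems.AnisotropyChord.Transfer.Fibre3

namespace FinXD

/-- row-D sub-cell `[13874801976466197, 13961519488819110]` of `L = 10`. [folklore] -/
theorem xd10s_129_0 : xdCellAny0 10 (49/50 : ℚ) 13874801976466197 13961519488819110 (1/25 : ℚ) = true := by decide +kernel

/-- row-D sub-cell `[13961519488819110, 14048237001172024]` of `L = 10`. [folklore] -/
theorem xd10s_129_1 : xdCellAny0 10 (49/50 : ℚ) 13961519488819110 14048237001172024 (1/25 : ℚ) = true := by decide +kernel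

/-- row-D sub-cell `[14048237001172024, 14134954513524937]` of `L = 10`. [folklore] -/
theorem xd10s_129_2 : xdCellAny0 10 (49/50 : ℚ) 14048237001172024 14134954513524937 (1/25 : ℚ) = true := by decide +kernel

/-- row-D sub-cell `[14134954513524937, 14221672025877851]` of `L = 10`. [folklore] -/
theorem xd10s_129_3 : xdCellAny0 10 (49/50 : ℚ) 14134954513524937 14221672025877851 (1/25 : ℚ) = true := by decide +kernel

/-- row-D sub-cell `[14221672025877851, 14310557476039588]` of `L = 10`. [folklore] -/
theorem xd10s_130_0 : xdCellAny0 10 (49/50 : ℚ) 14221672025877851 14310557476039588 (1/25 : ℚ) = true := by decide +kernel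

/-- row-D sub-cell `[14310557476039588, 14399442926201325]` of `L = 10`. [folklore] -/
theorem xd10s_130_1 : xdCellAny0 10 (49/50 : ℚ) 14310557476039588 14399442926201325 (1/25 : ℚ) = true := by decide +kernel

end FinXD

end Summit.HubbardSuperconductivity.HubbardSuperconductivity.Theorems.AnisotropyChord.Transfer.Fibre3
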